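import Summits.Ventures.PackingBounds.Configurations.P13aCode
import Summits.Ventures.PackingBounds.Kissing.DimensionThirteen

/-!
# A `P₁₃ₐ`-type local arrangement: `κ(13) ≥ 1130` in Lean

Framing: lottery ticket; floor = certified bounds/negative ranges. Venture `PackingBounds` (cell
`pub-packcert`, seat `pub-packcert-energy`).

Leech–Sloane's `P₁₃ₐ` (Conway–Sloane, *SPLAG* Ch. 5 §4.3, Table 1.2: `840 + 2 · 144 + 2 = 1130`): stack translates of
`P₁₂ₐ` by multiples of `((½)¹², ±1)`. Around a centre one sees the `840` in-layer vectors of Construction A (`±2e_i` and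
`(±1)⁴` on `51` four-sets), the `2 · 144` vectors `((±½)¹², ±1)` whose sign patterns run through a `(12,144,4)` code
`D` (pairwise at Hamming distance `≥ 4`, so two of them in the same layer have inner product `≤ 3 − 2 + 1 = 2`), and
the two vectors `(0¹², ±2)`. We take `D` = the `132` hexads of the Steiner system `S(5,6,12)` (from the Paley matrix
`H₁₂`) plus six pair words and six co-pair words [SPLAG Ch. 5 §2.6], and the `51` four-sets of
`KissingConstructionA.lean` (any `(12,144,4)` code and any such four-sets work: the in-layer/adjacent-layer inner
products are `≤ 4 · ½ = 2` automatically). Integer model at scale `2` in `ℤ²⁴` (cells `0..11`, the `13`-th axis on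
cell `12`; norm `16`, kissing condition `ip ≤ 8`): **`κ(13) ≥ 1130`** (`exists_kissing_1130`; SPLAG Table 1.2 value —
the record is `1154`, Zinoviev–Ericson 1999, not constructed here); bracket `1130 ≤ κ(13) ≤ 2233`.

## References
* J. H. Conway, N. J. A. Sloane, *Sphere Packings, Lattices and Groups*, Ch. 5 §§2.6, 4.3, Table 1.2. [`ConwaySloane1999`]
-/

namespace Summit.Ventures.PackingBounds.Config.ConsA

open Finset Leech Golay CL17

attribute [local irreducible] consA blockVecs pointVecs

/-! ### The three parts -/

/-- Central layer: `P₁₂ₐ`-type Construction A arrangement at scale `2`, `840` vectors. -/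
def central13 : Finset (Fin 24 → ℤ) := (consA 12 51 blk12).image fun x => (2 : ℤ) • x

/-- Adjacent layers: `288` vectors. -/
def layer13 : Finset (Fin 24 → ℤ) := (range 144 ×ˢ (univ : Finset Bool)).image fun q => lvec12 (dcode q.1) q.2

/-- Outer layers: `2` vectors. -/
def outer13 : Finset (Fin 24 → ℤ) := (univ : Finset Bool).image tvec12

/-- **The `P₁₃ₐ`-type local arrangement** (`1130` vectors of norm `16`). [cite: ConwaySloane1999, Ch. 5 §4.3] -/
def p13a : Finset (Fin 24 → ℤ) := central13 ∪ layer13 ∪ outer13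

attribute [irreducible] central13 layer13 outer13 p13a

/-- Facts of the central Construction A arrangement. -/
theorem p12a_hyp : (12 ≤ 16) ∧ (∀ b < 51, popK 24 24 (blk12 b) = 4 ∧ blk12 b < 2 ^ 12) ∧
    ∀ b < 51, ∀ b' < 51, b = b' ∨ popK 24 24 (blk12 b &&& blk12 b') ≤ 2 :=
  ⟨by norm_num, blk12_facts.1, blk12_facts.2⟩

/-- Members of the central layer. -/
theorem central13_props {x : Fin 24 → ℤ} (hx : x ∈ central13) : ∃ y ∈ consA 12 51 blk12, x = (2 : ℤ) • y ∧
    ∃ S : Finset (Fin 24), ∃ f : Fin 24 → Bool, ∃ a : ℤ, (∀ j ∈ S, j.val < 12) ∧ y = pvec S f a 0 ∧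
      ((a = 1 ∧ S.card = 4) ∨ (a = 2 ∧ S.card = 1)) := by
  rw [central13] at hx
  obtain ⟨y, hy, rfl⟩ := mem_image.mp hx
  refine ⟨y, hy, rfl, ?_⟩
  rw [consA, mem_union] at hy
  rcases hy with hy | hy
  · obtain ⟨b, hb, hyb⟩ := mem_biUnion.mp hy
    rw [mem_range] at hb
    obtain ⟨T, _, rfl⟩ := mem_blockVecs.mp hyb
    exact ⟨_, _, _, fun j hj => val_lt_of_mem_supp_lt (p12a_hyp.2.1 b hb).2 hj, rfl,
      Or.inl ⟨rfl, card_supp_blk p12a_hyp.2.1 hb⟩⟩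
  · obtain ⟨j, c, hj, rfl⟩ := mem_pointVecs.mp hy
    exact ⟨_, _, _, fun i hi => by rw [Finset.mem_singleton] at hi; subst hi; exact hj, rfl,
      Or.inr ⟨rfl, Finset.card_singleton j⟩⟩

/-- Members of the adjacent layers. -/
theorem mem_layer13 {x : Fin 24 → ℤ} (hx : x ∈ layer13) : ∃ a < 144, ∃ g : Bool, x = lvec12 (dcode a) g := by
  simp only [layer13, mem_image, mem_product, mem_range, mem_univ, and_true, Prod.exists] at hx
  obtain ⟨a, g, ha, rfl⟩ := hx
  exact ⟨a, ha, g, rfl⟩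

/-- Members of the outer layers. -/
theorem mem_outer13 {x : Fin 24 → ℤ} (hx : x ∈ outer13) : ∃ g : Bool, x = tvec12 g := by
  simp only [outer13, mem_image, mem_univ, true_and] at hx
  obtain ⟨g, rfl⟩ := hx
  exact ⟨g, rfl⟩

/-! ### Cardinalities -/

/-- `|central13| = 840`. -/
theorem card_central13 : central13.card = 840 := by
  rw [central13, card_image_of_injective _ (smul_right_injective _ (by norm_num : (2 : ℤ) ≠ 0)),
    card_consA p12a_hyp.1 p12a_hyp.2.1 p12a_hyp.2.2]

/-- The norm of an adjacent-layer vector. -/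
theorem ip_lvec12_self (d : ℕ) (g : Bool) : ip (lvec12 d g) (lvec12 d g) = 16 := by
  rw [ip_lvec12, Nat.xor_self]; simp

set_option maxRecDepth 100000 in
/-- `|layer13| = 288`. -/
theorem card_layer13 : layer13.card = 288 := by
  rw [layer13, card_image_of_injOn]
  · simp
  rintro ⟨a, g⟩ hq ⟨a', g'⟩ hq' h
  simp only [coe_product, Set.mem_prod, mem_coe, mem_range, mem_univ, and_true] at hq hq'
  change lvec12 (dcode a) g = lvec12 (dcode a') g' at h
  have e := ip_lvec12 (dcode a) (dcode a') g g'
  rw [h, ip_lvec12_self] at e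
  have hD := Nat.cast_nonneg (α := ℤ) ((cells12.filter fun j : Fin 24 => (dcode a ^^^ dcode a').testBit j.val = true).card)
  rcases sgn_cases (g ^^ g') with hs | hs <;> rw [hs] at e
  · have hgg : g = g' := by revert hs; cases g <;> cases g' <;> simp
    subst hgg
    by_contra hne
    have hne' : a ≠ a' := fun e' => hne (by rw [e'])
    have h4 := dcode_dist hq hq' hne'
    rw [← card_cells12_filter (Nat.xor_lt_two_pow (dcode_lt a hq) (dcode_lt a' hq'))] at h4
    omega
  · omega

/-- `|outer13| = 2`. -/
theorem card_outer13 : outer13.card = 2 := by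
  rw [outer13, card_image_of_injective]
  · simp
  intro g g' h
  have e := congrFun h 12
  simp only [tvec12] at e
  rw [pvec_apply_of_lt _ _ _ _ (by decide), pvec_apply_of_lt _ _ _ _ (by decide), if_pos (Finset.mem_singleton_self _),
    if_pos (Finset.mem_singleton_self _)] at e
  exact sgn_injective (by omega)

/-- The value on the `13`-th axis separates the parts: `0`, `±2`, `±4`. -/
theorem apply12_parts {x : Fin 24 → ℤ} :
    (x ∈ central13 → x 12 = 0) ∧ (x ∈ layer13 → x 12 = 2 ∨ x 12 = -2) ∧ (x ∈ outer13 → x 12 = 4 ∨ x 12 = -4) := by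
  refine ⟨fun hx => ?_, fun hx => ?_, fun hx => ?_⟩
  · obtain ⟨y, -, rfl, S, f, a, hS, rfl, -⟩ := central13_props hx
    have h12 : (12 : Fin 24) ∉ S := fun h => absurd (hS _ h) (by decide)
    rw [Pi.smul_apply, pvec_apply_of_lt _ _ _ _ (by decide), if_neg h12, smul_zero]
  · obtain ⟨a, -, g, rfl⟩ := mem_layer13 hx
    rw [lvec12, Pi.add_apply, pvec_apply_of_lt _ _ _ _ (by decide), pvec_apply_of_lt _ _ _ _ (by decide),
      if_neg (by decide), if_pos (Finset.mem_singleton_self _)]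
    rcases sgn_cases g with h | h <;> rw [h] <;> simp
  · obtain ⟨g, rfl⟩ := mem_outer13 hx
    rw [tvec12, pvec_apply_of_lt _ _ _ _ (by decide), if_pos (Finset.mem_singleton_self _)]
    rcases sgn_cases g with h | h <;> rw [h] <;> simp

/-- **`|P₁₃ₐ| = 840 + 288 + 2 = 1130`.** -/
theorem card_p13a : p13a.card = 1130 := by
  have d1 : Disjoint central13 layer13 := Finset.disjoint_left.mpr fun x h1 h2 => by
    have := apply12_parts.1 h1; rcases apply12_parts.2.1 h2 with h | h <;> omega
  have d2 : Disjoint (central13 ∪ layer13) outer13 := by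
    rw [disjoint_union_left]
    exact ⟨Finset.disjoint_left.mpr fun x h1 h2 => by
        have := apply12_parts.1 h1; rcases apply12_parts.2.2 h2 with h | h <;> omega,
      Finset.disjoint_left.mpr fun x h1 h2 => by
        rcases apply12_parts.2.1 h1 with h | h <;> rcases apply12_parts.2.2 h2 with h' | h' <;> omega⟩
  rw [p13a, card_union_of_disjoint d2, card_union_of_disjoint d1, card_central13, card_layer13, card_outer13]

/-! ### Norms and inner products -/

/-- A Construction-A vector against an adjacent-layer vector: `≤ 4`. -/
theorem ip_consA_lvec12 {y : Fin 24 → ℤ} {S : Finset (Fin 24)} {f : Fin 24 → Bool} {a : ℤ}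
    (hS : ∀ j ∈ S, j.val < 12) (hy : y = pvec S f a 0) (ha : (a = 1 ∧ S.card = 4) ∨ (a = 2 ∧ S.card = 1))
    (d : ℕ) (g : Bool) : ip y (lvec12 d g) ≤ 4 := by
  subst hy
  have hSc : S ⊆ cells := fun j hj => mem_cells.mpr (by have := hS j hj; omega)
  have hpos : (0 : ℤ) ≤ a * 1 := by rcases ha with ⟨rfl, -⟩ | ⟨rfl, -⟩ <;> norm_num
  have h := ip_pvec_pvec_le_inter hSc cells12_sub f (fun j => d.testBit j.val) hpos 0 0
  have h0 : ip (pvec S f a 0) (pvec {(12 : Fin 24)} (fun _ => g) 2 0) = 0 := by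
    rw [ip_pvec_pvec hSc axis12_sub]
    have : S ∩ {(12 : Fin 24)} = ∅ := by
      ext j; simp only [Finset.mem_inter, Finset.mem_singleton, Finset.notMem_empty, iff_false, not_and]
      rintro hj rfl; exact absurd (hS _ hj) (by decide)
    rw [this]; simp
  have hle : ((S ∩ cells12).card : ℤ) ≤ S.card := by exact_mod_cast card_le_card inter_subset_left
  rw [lvec12, ip_add_right, h0, add_zero]
  rcases ha with ⟨rfl, h4⟩ | ⟨rfl, h1⟩
  · rw [h4] at hle; push_cast at hle h ⊢; linarith
  · rw [h1] at hle; push_cast at hle h ⊢; linarith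

/-- Every vector of `P₁₃ₐ` vanishes on the coordinates `≥ 13` and has norm `16`. -/
theorem props_of_mem_p13a {x : Fin 24 → ℤ} (hx : x ∈ p13a) :
    (∀ j : Fin 24, 13 ≤ j.val → x j = 0) ∧ ip x x = 16 := by
  rw [p13a, mem_union, mem_union] at hx
  rcases hx with (hx | hx) | hx
  · obtain ⟨y, -, rfl, S, f, a, hS, rfl, ha⟩ := central13_props hx
    have hSc : S ⊆ cells := fun j hj => mem_cells.mpr (by have := hS j hj; omega)
    refine ⟨fun j hj => ?_, ?_⟩
    · have hjS : j ∉ S := fun h => by have := hS j h; omega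
      simp [pvec, hjS]
    · rw [ip_two_smul, ip_pvec_self hSc]
      rcases ha with ⟨rfl, h⟩ | ⟨rfl, h⟩ <;> rw [h] <;> norm_num
  · obtain ⟨a, -, g, rfl⟩ := mem_layer13 hx
    refine ⟨fun j hj => ?_, ?_⟩
    · have h1 : j ∉ cells12 := fun h => by rw [cells12, mem_filter] at h; omega
      have h2 : j ∉ ({(12 : Fin 24)} : Finset (Fin 24)) := fun h => by
        rw [Finset.mem_singleton] at h; subst h; exact absurd hj (by decide)
      simp [lvec12, pvec, h1, h2]
    · rw [ip_lvec12, Nat.xor_self]; simp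
  · obtain ⟨g, rfl⟩ := mem_outer13 hx
    refine ⟨fun j hj => ?_, ?_⟩
    · have h2 : j ∉ ({(12 : Fin 24)} : Finset (Fin 24)) := fun h => by
        rw [Finset.mem_singleton] at h; subst h; exact absurd hj (by decide)
      simp [tvec12, pvec, h2]
    · rw [tvec12, ip_axis12]; simp

/-- **All pairwise inner products of distinct vectors of `P₁₃ₐ` are `≤ 8`.** -/
theorem ip_le_of_mem_p13a {x x' : Fin 24 → ℤ} (hx : x ∈ p13a) (hx' : x' ∈ p13a) (hne : x ≠ x') : ip x x' ≤ 8 := by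
  -- central against the other parts
  have hCL : ∀ {u v : Fin 24 → ℤ}, u ∈ central13 → v ∈ layer13 ∨ v ∈ outer13 → ip u v ≤ 8 := by
    intro u v hu hv
    obtain ⟨y, -, rfl, S, f, a, hS, hy, ha⟩ := central13_props hu
    have h2 : ip ((2 : ℤ) • y) v = 2 * ip y v := by
      simp only [ip, Pi.smul_apply, smul_eq_mul, Finset.mul_sum]
      exact Finset.sum_congr rfl fun j _ => by ring
    rw [h2]
    rcases hv with hv | hv
    · obtain ⟨b, -, g, rfl⟩ := mem_layer13 hv
      linarith [ip_consA_lvec12 hS hy ha (dcode b) g]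
    · obtain ⟨g, rfl⟩ := mem_outer13 hv
      have hSc : S ⊆ cells := fun j hj => mem_cells.mpr (by have := hS j hj; omega)
      have h0 : ip y (tvec12 g) = 0 := by
        rw [hy, tvec12, ip_pvec_pvec hSc axis12_sub]
        have : S ∩ {(12 : Fin 24)} = ∅ := by
          ext j; simp only [Finset.mem_inter, Finset.mem_singleton, Finset.notMem_empty, iff_false, not_and]
          rintro hj rfl; exact absurd (hS _ hj) (by decide)
        rw [this]; simp
      rw [h0]; norm_num
  -- layer against outer
  have hLO : ∀ {u v : Fin 24 → ℤ}, u ∈ layer13 → v ∈ outer13 → ip u v ≤ 8 := by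
    intro u v hu hv
    obtain ⟨b, -, g, rfl⟩ := mem_layer13 hu
    obtain ⟨g', rfl⟩ := mem_outer13 hv
    rw [lvec12, tvec12, ip_add_left, ip_cells12_axis12, ip_axis12, zero_add]
    rcases sgn_cases (g ^^ g') with h | h <;> rw [h] <;> norm_num
  rw [p13a, mem_union, mem_union] at hx hx'
  rcases hx with (hx | hx) | hx <;> rcases hx' with (hx' | hx') | hx'
  · obtain ⟨y, hy, rfl, -⟩ := central13_props hx
    obtain ⟨y', hy', rfl, -⟩ := central13_props hx'
    rw [ip_two_smul]
    have := ip_le_of_mem_consA p12a_hyp.1 p12a_hyp.2.1 p12a_hyp.2.2 hy hy' (fun h => hne (by rw [h]))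
    linarith
  · exact hCL hx (Or.inl hx')
  · exact hCL hx (Or.inr hx')
  · rw [ip_comm]; exact hCL hx' (Or.inl hx)
  · obtain ⟨b, hb, g, rfl⟩ := mem_layer13 hx
    obtain ⟨b', hb', g', rfl⟩ := mem_layer13 hx'
    rw [ip_lvec12]
    by_cases hbb : b = b'
    · subst hbb
      have hgg : g ≠ g' := fun h => hne (by rw [h])
      have hs : sgn (g ^^ g') = -1 := by revert hgg; cases g <;> cases g' <;> simp
      rw [hs]
      linarith [Nat.cast_nonneg (α := ℤ) ((cells12.filter fun j : Fin 24 =>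
        (dcode b ^^^ dcode b).testBit j.val = true).card)]
    · have h4 := dcode_dist hb hb' hbb
      rw [← card_cells12_filter (Nat.xor_lt_two_pow (dcode_lt b hb) (dcode_lt b' hb'))] at h4
      rcases sgn_cases (g ^^ g') with h | h <;> rw [h] <;> push_cast <;> omega
  · exact hLO hx hx'
  · rw [ip_comm]; exact hCL hx' (Or.inr hx)
  · rw [ip_comm]; exact hLO hx' hx
  · obtain ⟨g, rfl⟩ := mem_outer13 hx
    obtain ⟨g', rfl⟩ := mem_outer13 hx'
    have hgg : g ≠ g' := fun h => hne (by rw [h])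
    rw [tvec12, tvec12, ip_axis12]
    have hs : sgn (g ^^ g') = -1 := by revert hgg; cases g <;> cases g' <;> simp
    rw [hs]; norm_num

/-! ### Transfer to `ℝ¹³` -/

/-- **`κ(13) ≥ 1130`** (a `P₁₃ₐ`-type local arrangement): `1130` unit vectors of `ℝ¹³` with pairwise inner products
`≤ 1/2`. [cite: ConwaySloane1999, Table 1.2] -/
theorem exists_kissing_1130 : ∃ C : Finset (EuclideanSpace ℝ (Fin 13)),
    C.card = 1130 ∧ (∀ x ∈ C, ‖x‖ = 1) ∧ (∀ x ∈ C, ∀ y ∈ C, x ≠ y → inner ℝ x y ≤ 1 / 2) := by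
  set K := p13a.image (toE 16) with hK
  have hKc : K.card = 1130 := by
    rw [hK, card_image_of_injective _ (toE_injective (by norm_num)), card_p13a]
  have hKn : ∀ p ∈ K, ‖p‖ = 1 := by
    intro p hp
    obtain ⟨x, hx, rfl⟩ := mem_image.mp hp
    exact norm_toE (by norm_num) (by rw [(props_of_mem_p13a hx).2]; norm_num)
  have hKi : ∀ p ∈ K, ∀ q ∈ K, p ≠ q → inner ℝ p q ≤ 1 / 2 := by
    intro p hp q hq hpq
    obtain ⟨x, hx, rfl⟩ := mem_image.mp hp
    obtain ⟨y, hy, rfl⟩ := mem_image.mp hq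
    rw [inner_toE (by norm_num), div_le_iff₀ (by norm_num)]
    have h : (ip x y : ℝ) ≤ 8 := by exact_mod_cast ip_le_of_mem_p13a hx hy (fun h => hpq (by rw [h]))
    linarith
  have hKo : ∀ p ∈ K, ∀ i : Fin 11,
      inner ℝ (EuclideanSpace.single (⟨13 + i.val, by omega⟩ : Fin 24) (1 : ℝ)) p = 0 := by
    intro p hp i
    obtain ⟨x, hx, rfl⟩ := mem_image.mp hp
    rw [EuclideanSpace.inner_single_left, map_one, one_mul, toE_apply,
      (props_of_mem_p13a hx).1 ⟨13 + i.val, by omega⟩ (by simp)]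
    simp
  obtain ⟨C', hc, hno, hi, _⟩ := exists_transfer_orthogonal (m := 24) (n := 13) (k := 11) (by norm_num)
    (fun i : Fin 11 => EuclideanSpace.single (⟨13 + i.val, by omega⟩ : Fin 24) (1 : ℝ))
    (linearIndependent_tail 13 11 (by norm_num)) K hKo
  refine ⟨C', by rw [hc, hKc], fun x' hx' => ?_, fun x' hx' y' hy' hne => ?_⟩
  · obtain ⟨x, hx, he⟩ := hno x' hx'
    rw [he]; exact hKn x hx
  · obtain ⟨x, hx, y, hy, hxy, he⟩ := hi x' hx' y' hy' hne
    rw [he]; exact hKi x hx y hy hxy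

/-- **`1130 ≤ κ(13) ≤ 2233` in Lean.** -/
theorem kissing_dim13_bracket :
    (∃ C : Finset (EuclideanSpace ℝ (Fin 13)), C.card = 1130 ∧ (∀ x ∈ C, ‖x‖ = 1) ∧
      (∀ x ∈ C, ∀ y ∈ C, x ≠ y → inner ℝ x y ≤ 1 / 2)) ∧
    ∀ C : Finset (EuclideanSpace ℝ (Fin 13)), (∀ x ∈ C, ‖x‖ = 1) →
      (∀ x ∈ C, ∀ y ∈ C, x ≠ y → inner ℝ x y ≤ 1 / 2) → C.card ≤ 2233 :=
  ⟨exists_kissing_1130, Kissing.kissing_dim13_le_2233⟩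

end Summit.Ventures.PackingBounds.Config.ConsA
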